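import Summits.HubbardSuperconductivity.HubbardSuperconductivity.Theorems.AnisotropyChordSpinMonotoneTwoMagnonInvariant
import Summits.HubbardSuperconductivity.HubbardSuperconductivity.Theorems.AnisotropyChordSpinMonotoneResolventBranch
import Literature.Combinatorics.SimpleGraph.RankThreeStronglyRegular

/-!
# Route `AnisotropyChord`: the TWO-MAGNON RUNG of `U_vt` (TM-VT) PROVED on every connected
# vertex- and edge-transitive graph — all square tori `(ℤ/Lℤ)²` included (`M_Δ`, two-magnon sector)

**Theorem** (`twoMagnon_condensate_monotone_of_edgeTransitive`).  Let `G` be a finite connected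
graph which is vertex-transitive AND edge-transitive (`Literature…IsVertexTransitive`,
`…IsEdgeTransitive`; e.g. every square torus `torusGraph 2 L`, the cycles, `K_n`, hypercubes).  In the
two-magnon sector `S^z_tot = |V|/2 − 2` of `H(Δ) = xxzHamiltonian 1 G (−1) Δ`, for all
`Δ₁ ≤ Δ₂ ≤ 1` and normalised sector ground states `ψ₁` of `H(Δ₁)`, `ψ₂` of `H(Δ₂)`:
`Λ(ψ₁) ≤ Λ(ψ₂)`, `Λ(ψ) = Re⟨ψ, S⁺_tot S⁻_tot ψ⟩` — the rung `TwoMagnonVTCondensateMonotone` of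
`…SpinMonotoneDefs` on the edge-transitive class, and the two-magnon slice of `M_Δ`
(`TorusCondensateMonotone`) for EVERY torus side `L` (`torusTwoMagnon_condensate_monotone`).

This is the theory seat's one-contact-orbit theorem (`hubbard-h0-rotor-theory-1`, cycle 4, §22.3:
`w′(σ) = −2σ c φ|_S ⟨κ, 𝒯κ⟩ ≤ 0`), made unconditional and derivative-free:
1. Perron–Frobenius ⇒ the sector ground states are fixed by `Aut G` (`sectorGS_comp_eq_self`), so they
   live on the invariant block `𝓜 = K ∩ 𝓘`, where (edge-transitivity) the contact operator is RANK ONE: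
   `H(Δ)|_𝓜 = L + ((1−Δ)/|E|)|t⟩⟨t| + const`, `L = H(1) + |E|/4 ⪰ 0`, `L φ = 0` (`…TwoMagnonInvariant`);
2. the abstract rank-one resolvent branch (`flatOverlap_sq_le_of_rankOne_branch`,
   `…ResolventBranch`): the flat overlap `|⟨φ̂, ψ⟩|²` is non-increasing in the coupling;
3. vertex-transitivity: `Λ(ψ) = (4/|V|)|⟨φ,ψ⟩|² + (|V|−4)` on `𝓜` (`condensate_eq_flatOverlap`).
The end point `Δ₂ = 1` (coupling `0`) is the ferromagnetic state `ψ₂ ∝ φ` (Cauchy–Schwarz), and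
`Δ₁ = Δ₂` is Perron–Frobenius uniqueness.  No lower bound on `Δ₁` is needed.

What this does NOT say: nothing for graphs with two contact orbits (anisotropic tori, where the
theory seat found the monotonicity window to close for `Δ < −2.7`), nothing for `W ≥ 3` magnons.
H. Tasaki, *Physics and Mathematics of Quantum Many-Body Systems* (2020) §2.4, App. A.2–A.3; B. Simon,
*Trace Ideals* (2005) §11.  No definition is introduced.
-/

set_option linter.dupNamespace false

noncomputable section

namespace Summit.HubbardSuperconductivity.HubbardSuperconductivity.Theorems.AnisotropyChord.TwoMagnon

open Matrix Complex Finset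
open scoped ComplexOrder InnerProductSpace
open Literature.MathematicalPhysics.QuantumLattice Literature.Probability.LatticeModels
open Literature.Combinatorics.SimpleGraph (IsVertexTransitive)
open Literature.Combinatorics.SimpleGraph.LovaszThetaEdgeTransitive (IsEdgeTransitive)
open Literature.Combinatorics.SimpleGraph.RankThreeStronglyRegular (isRegularOfDegree_of_isVertexTransitive)
open Summit.HubbardSuperconductivity.HubbardSuperconductivity.Theorems.AnisotropyChord.OneMagnon
open Summit.HubbardSuperconductivity.HubbardSuperconductivity.Theorems.LevyLogBootstrap

variable {V : Type*} [Fintype V] [DecidableEq V]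

/-- Cauchy–Schwarz in dot-product form: `|⟨φ, ψ⟩|² ≤ ⟨φ,φ⟩ ⟨ψ,ψ⟩`. [folklore] -/
theorem norm_sq_star_dotProduct_le (φ ψ : (V → Fin 2) → ℂ) :
    ‖star φ ⬝ᵥ ψ‖ ^ 2 ≤ (star φ ⬝ᵥ φ).re * (star ψ ⬝ᵥ ψ).re := by
  have h1 : star φ ⬝ᵥ ψ = ⟪(WithLp.toLp 2 φ : EuclideanSpace ℂ (V → Fin 2)), WithLp.toLp 2 ψ⟫_ℂ :=
    star_coe_dotProduct_eq_inner (WithLp.toLp 2 φ) ψ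
  have hn : ∀ x : (V → Fin 2) → ℂ, (star x ⬝ᵥ x).re = ‖(WithLp.toLp 2 x : EuclideanSpace ℂ (V → Fin 2))‖ ^ 2 := by
    intro x
    have h := inner_self_eq_norm_sq_to_K (𝕜 := ℂ) (WithLp.toLp 2 x : EuclideanSpace ℂ (V → Fin 2))
    rw [EuclideanSpace.inner_eq_star_dotProduct, dotProduct_comm] at h
    have h2 : star x ⬝ᵥ x = ((‖(WithLp.toLp 2 x : EuclideanSpace ℂ (V → Fin 2))‖ : ℝ) : ℂ) ^ 2 := h
    rw [h2, ← Complex.ofReal_pow, Complex.ofReal_re]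
  rw [h1, hn, hn, ← mul_pow]
  exact pow_le_pow_left₀ (norm_nonneg _) (norm_inner_le_norm _ _) 2

/-- **The two-magnon rung TM-VT of `U_vt` on connected vertex- and edge-transitive graphs** (see the
module docstring): in the sector `S^z_tot = |V|/2 − 2`, for `Δ₁ ≤ Δ₂ ≤ 1` and normalised sector ground
states, `Λ(ψ₁) ≤ Λ(ψ₂)`.  Tasaki (2020) §2.4, App. A; theory seat `hubbard-h0-rotor-theory-1` cycle 4
§22–23 (one contact orbit). [folklore] -/
theorem twoMagnon_condensate_monotone_of_edgeTransitive (G : SimpleGraph V) [DecidableRel G.Adj]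
    (hG : G.Connected) (hVT : IsVertexTransitive G) (hET : IsEdgeTransitive G)
    {Δ₁ Δ₂ : ℝ} (h12 : Δ₁ ≤ Δ₂) (h2 : Δ₂ ≤ 1) {ψ₁ ψ₂ : (V → Fin 2) → ℂ}
    (g₁m : ψ₁ ∈ spinZSector (Λ := V) 1 ((Fintype.card V : ℝ) / 2 - 2)) (g₁n : star ψ₁ ⬝ᵥ ψ₁ = 1)
    (g₁e : xxzHamiltonian 1 G (-1) Δ₁ *ᵥ ψ₁ =
      ((lowestEnergyInSector 1 (xxzHamiltonian 1 G (-1) Δ₁) ((Fintype.card V : ℝ) / 2 - 2) : ℝ) : ℂ) • ψ₁)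
    (g₂m : ψ₂ ∈ spinZSector (Λ := V) 1 ((Fintype.card V : ℝ) / 2 - 2)) (g₂n : star ψ₂ ⬝ᵥ ψ₂ = 1)
    (g₂e : xxzHamiltonian 1 G (-1) Δ₂ *ᵥ ψ₂ =
      ((lowestEnergyInSector 1 (xxzHamiltonian 1 G (-1) Δ₂) ((Fintype.card V : ℝ) / 2 - 2) : ℝ) : ℂ) • ψ₂) :
    (star ψ₁ ⬝ᵥ (((∑ x, onSite x (spinRaise 1)) * (∑ y, onSite y (spinLower 1)) : Op V 2) *ᵥ ψ₁)).re ≤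
      (star ψ₂ ⬝ᵥ (((∑ x, onSite x (spinRaise 1)) * (∑ y, onSite y (spinLower 1)) : Op V 2) *ᵥ ψ₂)).re := by
  -- Step 0: a weight-2 configuration, an edge, regularity
  have hψ₁0 : ψ₁ ≠ 0 := by
    intro h; rw [h, dotProduct_zero] at g₁n; exact zero_ne_one g₁n
  have hψ₂0 : ψ₂ ≠ 0 := by
    intro h; rw [h, dotProduct_zero] at g₂n; exact zero_ne_one g₂n
  have hsupp₁ := apply_eq_zero_of_mem_twoMagnonSector g₁m
  obtain ⟨σ₀, hσ₀⟩ := Function.ne_iff.mp hψ₁0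
  have hw : (∑ z, (σ₀ z : ℕ)) = 2 := by
    by_contra h
    exact hσ₀ (hsupp₁ σ₀ h)
  obtain ⟨i₀, j₀, hij₀, -⟩ := eq_pair_of_weight_eq_two hw
  have hm : G.edgeFinset.card ≠ 0 := by
    obtain ⟨p⟩ := hG.preconnected i₀ j₀
    cases p with
    | nil => exact absurd rfl hij₀
    | cons h _ =>
      exact Finset.card_ne_zero_of_mem (SimpleGraph.mem_edgeFinset.2 ((SimpleGraph.mem_edgeSet G).2 h))
  have hmpos : (0 : ℝ) < G.edgeFinset.card := by exact_mod_cast Nat.pos_of_ne_zero hm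
  have hreg : G.IsRegularOfDegree (G.degree i₀) := isRegularOfDegree_of_isVertexTransitive hVT i₀
  set k : ℕ := G.degree i₀ with hkdef
  set m : ℕ := G.edgeFinset.card with hmdef
  -- flat vector, contact indicator
  set φ : (V → Fin 2) → ℂ := fun σ => if (∑ z, (σ z : ℕ)) = 2 then 1 else 0 with hφdef
  have hφ : ∀ σ, φ σ = if (∑ z, (σ z : ℕ)) = 2 then 1 else 0 := fun σ => rfl
  obtain ⟨t, ht2, ht0⟩ := exists_adjInd G
  -- Perron–Frobenius: the sector ground states are fixed by the automorphisms
  have hfix₁ : ∀ π : V ≃ V, (∀ x y, G.Adj (π x) (π y) ↔ G.Adj x y) → ∀ σ, ψ₁ (σ ∘ π) = ψ₁ σ :=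
    fun π hπ σ => congrFun (sectorGS_comp_eq_self G hG Δ₁ _ π hπ g₁m g₁e) σ
  have hfix₂ : ∀ π : V ≃ V, (∀ x y, G.Adj (π x) (π y) ↔ G.Adj x y) → ∀ σ, ψ₂ (σ ∘ π) = ψ₂ σ :=
    fun π hπ σ => congrFun (sectorGS_comp_eq_self G hG Δ₂ _ π hπ g₂m g₂e) σ
  -- the condensate as a flat overlap
  rw [condensate_eq_flatOverlap G hVT i₀ hφ g₁m hfix₁, condensate_eq_flatOverlap G hVT i₀ hφ g₂m hfix₂,
    g₁n, g₂n]
  have hn : (0 : ℝ) < Fintype.card V := by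
    have : 0 < Fintype.card V := Fintype.card_pos_iff.2 ⟨i₀⟩
    exact_mod_cast this
  suffices hkey : ‖star φ ⬝ᵥ ψ₁‖ ^ 2 ≤ ‖star φ ⬝ᵥ ψ₂‖ ^ 2 by
    have h4 : 0 ≤ 4 / (Fintype.card V : ℝ) := by positivity
    nlinarith [mul_le_mul_of_nonneg_left hkey h4]
  -- ⟨φ, φ⟩ = N, a positive natural number
  obtain ⟨N, hNdef⟩ : ∃ N : ℕ, N = (Finset.univ.filter fun σ : V → Fin 2 => (∑ z, (σ z : ℕ)) = 2).card :=
    ⟨_, rfl⟩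
  have hφφ : star φ ⬝ᵥ φ = (N : ℂ) := by
    rw [star_flat_dotProduct hφ (fun σ h => by rw [hφ σ, if_neg h]), hNdef, Finset.card_filter]
    push_cast
    exact Finset.sum_congr rfl fun σ _ => by rw [hφ σ]
  have hNpos : 0 < N := by
    rw [hNdef, Finset.card_pos]
    exact ⟨σ₀, Finset.mem_filter.2 ⟨Finset.mem_univ _, hw⟩⟩
  have hNr : (star φ ⬝ᵥ φ).re = N := by rw [hφφ]; norm_cast
  -- Case `Δ₁ = Δ₂`: Perron–Frobenius uniqueness
  rcases h12.lt_or_eq with hlt | heq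
  swap
  · subst heq
    obtain ⟨c, hc⟩ := sectorGS_smul_of_sectorGS G hG Δ₁ _ g₁m hψ₁0 g₁e g₂m g₂e
    have hcc : ‖c‖ ^ 2 = 1 := by
      have h := g₂n
      rw [hc, star_smul, smul_dotProduct, dotProduct_smul, g₁n, smul_eq_mul, smul_eq_mul, mul_one,
        Complex.star_def, Complex.conj_mul'] at h
      exact_mod_cast h
    rw [hc, dotProduct_smul, smul_eq_mul, norm_mul, mul_pow, hcc, one_mul]
  -- Case `Δ₂ = 1`: the ferromagnetic end point, `ψ₂ ∝ φ`
  rcases h2.lt_or_eq with hlt2 | heq2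
  swap
  · subst heq2
    have hφ0 : φ ≠ 0 := by
      intro h
      have : (N : ℂ) = 0 := by rw [← hφφ, h, dotProduct_zero]
      exact hNpos.ne' (by exact_mod_cast this)
    obtain ⟨c, hc⟩ := sectorGS_at_one_eq_smul_flat G hG hφ hφ0 g₂m g₂e
    have hcc : ‖c‖ ^ 2 * N = 1 := by
      have h := g₂n
      rw [hc, star_smul, smul_dotProduct, dotProduct_smul, hφφ, smul_eq_mul, smul_eq_mul,
        Complex.star_def, ← mul_assoc, Complex.conj_mul'] at h
      exact_mod_cast h
    have h2' : ‖star φ ⬝ᵥ ψ₂‖ ^ 2 = N := by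
      rw [hc, dotProduct_smul, smul_eq_mul, norm_mul, mul_pow, hφφ, Complex.norm_natCast]
      nlinarith
    rw [h2']
    have h1' := norm_sq_star_dotProduct_le φ ψ₁
    rw [hNr, g₁n, Complex.one_re, mul_one] at h1'
    exact h1'
  -- Main case `Δ₁ < Δ₂ < 1`: the rank-one resolvent branch on the invariant block
  set K := spinZSector (Λ := V) 1 ((Fintype.card V : ℝ) / 2 - 2) with hKdef
  set 𝓘 : Submodule ℂ ((V → Fin 2) → ℂ) := ⨅ (π : V ≃ V),
    ⨅ (_ : ∀ x y, G.Adj (π x) (π y) ↔ G.Adj x y),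
      LinearMap.eqLocus (LinearMap.funLeft ℂ ℂ (fun σ : V → Fin 2 => σ ∘ π)) LinearMap.id with h𝓘def
  have hmem𝓘 : ∀ f : (V → Fin 2) → ℂ, f ∈ 𝓘 ↔
      ∀ π : V ≃ V, (∀ x y, G.Adj (π x) (π y) ↔ G.Adj x y) → ∀ σ, f (σ ∘ π) = f σ := by
    intro f
    simp only [h𝓘def, Submodule.mem_iInf, LinearMap.mem_eqLocus, LinearMap.id_coe, id_eq]
    constructor
    · intro h π hπ σ
      have h' := congrFun (h π hπ) σ
      rwa [LinearMap.funLeft_apply] at h'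
    · intro h π hπ
      funext σ
      rw [LinearMap.funLeft_apply]
      exact h π hπ σ
  set 𝓜 : Submodule ℂ ((V → Fin 2) → ℂ) := K ⊓ 𝓘 with h𝓜def
  have hmem𝓜 : ∀ f, f ∈ 𝓜 ↔ f ∈ K ∧
      ∀ π : V ≃ V, (∀ x y, G.Adj (π x) (π y) ↔ G.Adj x y) → ∀ σ, f (σ ∘ π) = f σ := by
    intro f
    rw [h𝓜def, Submodule.mem_inf, hmem𝓘]
  -- the operator `L = H(1) + m/4`
  set L : Op V 2 := xxzHamiltonian 1 G (-1) 1 + (((m : ℝ) / 4 : ℝ) : ℂ) • (1 : Op V 2) with hLdef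
  have hL : L.PosSemidef := posSemidef_xxzOne_add G
  have hLmul : ∀ v : (V → Fin 2) → ℂ, L *ᵥ v = xxzHamiltonian 1 G (-1) 1 *ᵥ v + (((m : ℝ) / 4 : ℝ) : ℂ) • v := by
    intro v
    rw [hLdef, add_mulVec, smul_mulVec, one_mulVec]
  have hH1inv := xxzHamiltonian_submatrix_comp 1 G (-1) 1
  have h𝓜L : ∀ v ∈ 𝓜, L *ᵥ v ∈ 𝓜 := by
    intro v hv
    obtain ⟨hvK, hvfix⟩ := (hmem𝓜 v).1 hv
    refine (hmem𝓜 _).2 ⟨?_, ?_⟩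
    · rw [hLmul]
      refine K.add_mem ?_ (K.smul_mem _ hvK)
      rw [xxz_at_one_eq_neg_heisenberg, neg_mulVec]
      exact K.neg_mem (heisenberg_mulVec_mem_spinZSector 1 G 1 hvK)
    · intro π hπ σ
      have hvπ : (fun σ => v (σ ∘ π)) = v := funext (hvfix π hπ)
      have h := congrFun (mulVec_comp_of_submatrix_eq π (hH1inv π hπ) v) σ
      rw [hvπ] at h
      rw [hLmul, Pi.add_apply, Pi.add_apply, Pi.smul_apply, Pi.smul_apply, ← h, hvfix π hπ σ]
  -- the normalised flat vector `e`
  obtain ⟨r, hrdef⟩ : ∃ r : ℝ, r = 1 / Real.sqrt (N : ℝ) := ⟨_, rfl⟩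
  have hNr0 : (0 : ℝ) < N := by exact_mod_cast hNpos
  have hrpos : 0 < r := by rw [hrdef]; exact div_pos one_pos (Real.sqrt_pos.2 hNr0)
  have hr2 : r ^ 2 * N = 1 := by
    rw [hrdef, div_pow, one_pow, Real.sq_sqrt hNr0.le]
    field_simp
  obtain ⟨e, hedef⟩ : ∃ e : (V → Fin 2) → ℂ, e = ((r : ℝ) : ℂ) • φ := ⟨_, rfl⟩
  have hφK : φ ∈ K := flat_mem_twoMagnonSector hφ
  have hφ𝓜 : φ ∈ 𝓜 := (hmem𝓜 φ).2 ⟨hφK, fun π _ σ => flat_comp_equiv hφ π σ⟩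
  have he𝓜 : e ∈ 𝓜 := by rw [hedef]; exact 𝓜.smul_mem _ hφ𝓜
  have ht𝓜 : t ∈ 𝓜 := (hmem𝓜 t).2 ⟨adjInd_mem_twoMagnonSector ht0, fun π hπ σ => adjInd_comp_equiv ht2 ht0 π hπ σ⟩
  have hψ₂𝓜 : ψ₂ ∈ 𝓜 := (hmem𝓜 ψ₂).2 ⟨g₂m, hfix₂⟩
  have hLφ : L *ᵥ φ = 0 := by
    rw [hLmul, xxzOne_mulVec_flat G hφ, ← add_smul]
    have : (-((G.edgeFinset.card : ℂ) / 4) + (((m : ℝ) / 4 : ℝ) : ℂ)) = 0 := by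
      rw [hmdef]; push_cast; ring
    rw [this, zero_smul]
  have hLe : L *ᵥ e = 0 := by rw [hedef, mulVec_smul, hLφ, smul_zero]
  have he1 : star e ⬝ᵥ e = 1 := by
    rw [hedef, star_smul, smul_dotProduct, dotProduct_smul, hφφ, smul_eq_mul, smul_eq_mul,
      Complex.star_def, Complex.conj_ofReal, ← mul_assoc, ← Complex.ofReal_mul, ← pow_two,
      ← Complex.ofReal_natCast, ← Complex.ofReal_mul, hr2, Complex.ofReal_one]
  have htφ : star t ⬝ᵥ φ = (m : ℂ) := star_adjInd_dotProduct_flat ht2 ht0 hφ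
  have ha0 : star e ⬝ᵥ t ≠ 0 := by
    rw [hedef, star_smul, smul_dotProduct, smul_eq_mul, Complex.star_def, Complex.conj_ofReal,
      star_dotProduct φ t, htφ]
    refine mul_ne_zero (by exact_mod_cast hrpos.ne') ?_
    rw [star_ne_zero]
    exact_mod_cast hm
  -- the rank-one eigen-equations on the invariant block
  set E₁ : ℝ := lowestEnergyInSector 1 (xxzHamiltonian 1 G (-1) Δ₁) ((Fintype.card V : ℝ) / 2 - 2) with hE₁def
  set E₂ : ℝ := lowestEnergyInSector 1 (xxzHamiltonian 1 G (-1) Δ₂) ((Fintype.card V : ℝ) / 2 - 2) with hE₂def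
  set c₁ : ℝ := (1 - Δ₁) * ((m : ℝ) / 4 - k) with hc₁def
  set c₂ : ℝ := (1 - Δ₂) * ((m : ℝ) / 4 - k) with hc₂def
  set s₁ : ℝ := (1 - Δ₁) / (m : ℝ) with hs₁def
  set s₂ : ℝ := (1 - Δ₂) / (m : ℝ) with hs₂def
  set ε₁ : ℝ := E₁ - c₁ + (m : ℝ) / 4 with hε₁def
  set ε₂ : ℝ := E₂ - c₂ + (m : ℝ) / 4 with hε₂def
  have hId₁ := xxz_mulVec_of_invariant hET hreg hm ht2 ht0 g₁m hfix₁
  have hId₂ := xxz_mulVec_of_invariant hET hreg hm ht2 ht0 g₂m hfix₂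
  have heig : ∀ {ψ : (V → Fin 2) → ℂ} {Δ E : ℝ},
      (∀ Δ', xxzHamiltonian 1 G (-1) Δ' *ᵥ ψ = xxzHamiltonian 1 G (-1) 1 *ᵥ ψ
        + (((1 - Δ') * ((G.edgeFinset.card : ℝ) / 4 - (G.degree i₀)) : ℝ) : ℂ) • ψ
        + ((((1 - Δ' : ℝ) : ℂ)) / (G.edgeFinset.card : ℂ) * (star t ⬝ᵥ ψ)) • t) →
      xxzHamiltonian 1 G (-1) Δ *ᵥ ψ = ((E : ℝ) : ℂ) • ψ →
      L *ᵥ ψ + ((((1 - Δ) / (m : ℝ) : ℝ) : ℂ) * (star t ⬝ᵥ ψ)) • t =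
        ((E - (1 - Δ) * ((m : ℝ) / 4 - k) + (m : ℝ) / 4 : ℝ) : ℂ) • ψ := by
    intro ψ Δ E hId hE
    have h := hId Δ
    rw [hE] at h
    funext σ
    have hσ := congrFun h σ
    simp only [Pi.add_apply, Pi.smul_apply, smul_eq_mul] at hσ ⊢
    rw [hLmul, Pi.add_apply, Pi.smul_apply, smul_eq_mul]
    rw [hmdef, hkdef]
    push_cast at hσ ⊢
    linear_combination -hσ
  have h₁ : L *ᵥ ψ₁ + (((s₁ : ℝ) : ℂ) * (star t ⬝ᵥ ψ₁)) • t = ((ε₁ : ℝ) : ℂ) • ψ₁ := heig hId₁ g₁e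
  have h₂ : L *ᵥ ψ₂ + (((s₂ : ℝ) : ℂ) * (star t ⬝ᵥ ψ₂)) • t = ((ε₂ : ℝ) : ℂ) • ψ₂ := heig hId₂ g₂e
  have hs₂ : 0 < s₂ := by rw [hs₂def]; exact div_pos (by linarith) hmpos
  -- `ε₂ ≤ ε₁` (variational principle at `Δ₂` tested on `ψ₁`)
  have hε : ε₂ ≤ ε₁ := by
    have hv : E₂ ≤ (star ψ₁ ⬝ᵥ (xxzHamiltonian 1 G (-1) Δ₂ *ᵥ ψ₁)).re :=
      sectorEnergy_le_re_form 1 G g₁m g₁n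
    have hf₂ := re_form_of_invariant hET hreg hm ht2 ht0 g₁m hfix₁ Δ₂
    have hf₁ := re_form_of_invariant hET hreg hm ht2 ht0 g₁m hfix₁ Δ₁
    have hE₁ : (star ψ₁ ⬝ᵥ (xxzHamiltonian 1 G (-1) Δ₁ *ᵥ ψ₁)).re = E₁ := re_form_of_sectorGS 1 G g₁n g₁e
    rw [g₁n, Complex.one_re, mul_one] at hf₁ hf₂
    have hb : 0 ≤ ‖star t ⬝ᵥ ψ₁‖ ^ 2 := by positivity
    have hcoef : (1 - Δ₂) / (G.edgeFinset.card : ℝ) ≤ (1 - Δ₁) / (G.edgeFinset.card : ℝ) :=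
      div_le_div_of_nonneg_right (by linarith) hmpos.le
    rw [hε₁def, hε₂def, hc₁def, hc₂def, hmdef, hkdef]
    nlinarith [mul_le_mul_of_nonneg_right hcoef hb]
  -- the variational property of `ε₁` on `𝓜 ∩ t^⊥`
  have hvar : ∀ f ∈ 𝓜, star t ⬝ᵥ f = 0 → ε₁ * (star f ⬝ᵥ f).re ≤ (star f ⬝ᵥ (L *ᵥ f)).re := by
    intro f hf hft
    obtain ⟨hfK, hffix⟩ := (hmem𝓜 f).1 hf
    have hv : E₁ * (star f ⬝ᵥ f).re ≤ (star f ⬝ᵥ (xxzHamiltonian 1 G (-1) Δ₁ *ᵥ f)).re :=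
      minEnergyOn_mul_le_re_rayleigh (xxzHamiltonian_isHermitian 1 G (-1) Δ₁) K hfK
    have hff := re_form_of_invariant hET hreg hm ht2 ht0 hfK hffix Δ₁
    rw [hft, norm_zero, zero_pow two_ne_zero, mul_zero, add_zero] at hff
    have hLf : (star f ⬝ᵥ (L *ᵥ f)).re =
        (star f ⬝ᵥ (xxzHamiltonian 1 G (-1) 1 *ᵥ f)).re + (m : ℝ) / 4 * (star f ⬝ᵥ f).re := by
      rw [hLmul, dotProduct_add, dotProduct_smul, Complex.add_re, smul_eq_mul, Complex.re_ofReal_mul]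
    rw [hLf, hε₁def, hc₁def, hmdef, hkdef]
    nlinarith
  -- the uniqueness property of `ε₂` on `𝓜 ∩ t^⊥`
  have hb₂ : star t ⬝ᵥ ψ₂ ≠ 0 :=
    sectorGS_contact_ne_zero hG hET hreg hm ht2 ht0 hφ g₂m g₂n g₂e hfix₂
  have huniq : ∀ g ∈ 𝓜, star t ⬝ᵥ g = 0 → L *ᵥ g = ((ε₂ : ℝ) : ℂ) • g → g = 0 := by
    intro g hg hgt hLg
    obtain ⟨hgK, hgfix⟩ := (hmem𝓜 g).1 hg
    -- `g` is a sector ground vector at `Δ₂`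
    have hHg : xxzHamiltonian 1 G (-1) Δ₂ *ᵥ g = ((E₂ : ℝ) : ℂ) • g := by
      have h := xxz_mulVec_of_invariant hET hreg hm ht2 ht0 hgK hgfix Δ₂
      rw [hgt, mul_zero, zero_smul, add_zero] at h
      have hL' : xxzHamiltonian 1 G (-1) 1 *ᵥ g = ((ε₂ : ℝ) : ℂ) • g - (((m : ℝ) / 4 : ℝ) : ℂ) • g := by
        rw [← hLg, hLmul, add_sub_cancel_right]
      rw [h, hL', hε₂def, hc₂def, hmdef, hkdef]
      funext σ
      simp only [Pi.add_apply, Pi.sub_apply, Pi.smul_apply, smul_eq_mul]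
      push_cast
      ring
    obtain ⟨c, hc⟩ := sectorGS_smul_of_sectorGS G hG Δ₂ _ g₂m hψ₂0 g₂e hgK hHg
    have hc0 : c = 0 := by
      rw [hc, dotProduct_smul, smul_eq_mul] at hgt
      rcases mul_eq_zero.1 hgt with h | h
      · exact h
      · exact absurd h hb₂
    rw [hc, hc0, zero_smul]
  -- the abstract rank-one branch lemma
  have key := flatOverlap_sq_le_of_rankOne_branch hL 𝓜 h𝓜L he𝓜 ht𝓜 hψ₂𝓜 hLe he1 ha0 hs₂ hε
    h₁ g₁n h₂ g₂n hb₂ hvar huniq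
  -- back to the flat vector `φ = e / r`
  have hconv : ∀ ψ : (V → Fin 2) → ℂ, ‖star e ⬝ᵥ ψ‖ ^ 2 = r ^ 2 * ‖star φ ⬝ᵥ ψ‖ ^ 2 := by
    intro ψ
    rw [hedef, star_smul, smul_dotProduct, smul_eq_mul, norm_mul, mul_pow, Complex.star_def,
      Complex.conj_ofReal, Complex.norm_real, Real.norm_eq_abs, sq_abs]
  rw [hconv, hconv] at key
  exact le_of_mul_le_mul_left key (pow_pos hrpos 2)

/-- **The rung `TwoMagnonVTCondensateMonotone` of `…SpinMonotoneDefs` on the edge-transitive class**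
(its statement verbatim, with the one extra hypothesis `IsEdgeTransitive G`): on every finite connected
vertex- and edge-transitive graph, in the two-magnon sector `S^z_tot = |V|/2 − 2`, for
`−1 ≤ Δ₁ ≤ Δ₂ ≤ 1`, the condensate of normalised sector ground states is non-decreasing from `Δ₁` to
`Δ₂`. [folklore] -/
theorem twoMagnonVT_of_edgeTransitive :
    ∀ (V : Type) [Fintype V] [DecidableEq V] (G : SimpleGraph V) [DecidableRel G.Adj],
      G.Connected → IsVertexTransitive G → IsEdgeTransitive G →
      ∀ (Δ₁ Δ₂ : ℝ), -1 ≤ Δ₁ → Δ₁ ≤ Δ₂ → Δ₂ ≤ 1 →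
      ∀ ψ₁ ψ₂ : TensorIndex V 2 → ℂ,
        ψ₁ ∈ spinZSector (Λ := V) 1 ((Fintype.card V : ℝ) / 2 - 2) → star ψ₁ ⬝ᵥ ψ₁ = 1 →
        xxzHamiltonian 1 G (-1) Δ₁ *ᵥ ψ₁ =
          ((lowestEnergyInSector 1 (xxzHamiltonian 1 G (-1) Δ₁) ((Fintype.card V : ℝ) / 2 - 2) : ℝ) : ℂ) • ψ₁ →
        ψ₂ ∈ spinZSector (Λ := V) 1 ((Fintype.card V : ℝ) / 2 - 2) → star ψ₂ ⬝ᵥ ψ₂ = 1 →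
        xxzHamiltonian 1 G (-1) Δ₂ *ᵥ ψ₂ =
          ((lowestEnergyInSector 1 (xxzHamiltonian 1 G (-1) Δ₂) ((Fintype.card V : ℝ) / 2 - 2) : ℝ) : ℂ) • ψ₂ →
        (star ψ₁ ⬝ᵥ (((∑ x, onSite x (spinRaise 1)) * (∑ y, onSite y (spinLower 1)) : Op V 2) *ᵥ ψ₁)).re
          ≤ (star ψ₂ ⬝ᵥ (((∑ x, onSite x (spinRaise 1)) * (∑ y, onSite y (spinLower 1)) : Op V 2) *ᵥ ψ₂)).re :=
  fun _ _ _ G _ hG hVT hET _ _ _ h12 h2 _ _ g₁m g₁n g₁e g₂m g₂n g₂e =>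
    twoMagnon_condensate_monotone_of_edgeTransitive G hG hVT hET h12 h2 g₁m g₁n g₁e g₂m g₂n g₂e

end Summit.HubbardSuperconductivity.HubbardSuperconductivity.Theorems.AnisotropyChord.TwoMagnon
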